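import Summits.RiemannHypothesis.RiemannHypothesis.Theorems.WeilColumnThetaEnvelopeE2
import HarnessLib

/-!
# The B-spline densities are symmetric-decreasing; the CELLWISE supremum of the cut's derivative (tier-2 `cpList`; RH-FREE)

WEIL column (LADDER-RH, W-P(P2); route `WeilSemilocal`, tier-2 twin residue, item 19172; cc-s2-1 gen22 TIER2-KERNEL-SPEC §1 (`cpList`),
§5 (K1); this seat's `T2Matches.cpb_ge` in `WeilColumnThetaUCT2Valid`). The kernel bounds `|χ′(x₁ − t)|` on the depth cell `[jτ, (j+1)τ]`
by its value at the point `t*` of the cell nearest the mode `η/2`. That needs: the B-spline density `bsplineDensity c k` (the `(k+1)`-fold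
convolution power of the uniform density on `[−c, c]`) is EVEN and NON-INCREASING IN `|t|`. Proof by induction on `k`: the uniform density
is; and if `ρ_k` is, then `ρ_{k+1}(t) = (F_k(t+c) − F_k(t−c))/(2c)` (`bsplineDensity_succ_re_eq`) satisfies, for `0 ≤ x ≤ y`,
`F_k(y+c) − F_k(x+c) = ∫_x^y ρ_k(s+c)ds ≤ ∫_x^y ρ_k(s−c)ds = F_k(y−c) − F_k(x−c)` since `|s − c| ≤ |s + c|` for `s ≥ 0`.

* `bsplineDensity_re_le_of_abs_le : |x| ≤ |y| → re ρ_k(y) ≤ re ρ_k(x)`;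
* `abs_cut_deriv_depth_le_cell : lo ≤ t ≤ hi → |χ′(x₁ − t)| ≤ re ρ(t* − η/2)`, `t* = max lo (min (η/2) hi)`, `ρ = bsplineDensity (η/(2m)) (m−1)`;
* `bsplineDensity_re_eq_irwinHall_sub : re ρ(v) = (m/η)·(irwinHall (m−1) (m(v+η/2)/η) − irwinHall (m−1) (m(v+η/2)/η − 1))` (`m ≥ 2`) —
  the exactly ℚ-evaluable form (`irwinHall_eq_IH`) of SPEC §1's `(m/η)·f_IH(m; m t*/η)`.
Nothing here bears on the truth of RH.
-/

set_option linter.dupNamespace false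

noncomputable section

open MeasureTheory Set Complex Filter
open scoped Real
open Literature.NumberTheory.LFunctions

namespace Summit.RiemannHypothesis.RiemannHypothesis.Theorems.WeilColumn.ThetaMellin

open ThetaParams

variable {c : ℝ}

/-! ## §1 Symmetric-decreasing B-spline densities -/

/-- The CDF increment as an interval integral: `F_k(b) − F_k(a) = ∫_a^b re ρ_k`. [folklore] -/
theorem bsplineCDF_sub_eq_integral (c : ℝ) (k : ℕ) (a b : ℝ) :
    bsplineCDF c k b - bsplineCDF c k a = ∫ s in a..b, (bsplineDensity c k s).re := by
  have hint := integrable_bsplineDensity_re c k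
  unfold bsplineCDF
  exact intervalIntegral.integral_Iic_sub_Iic hint.integrableOn hint.integrableOn

/-- The step of the induction, on `0 ≤ x ≤ y`: if `re ρ_k` is non-increasing in `|t|` then so is `re ρ_{k+1}` (`c > 0`). [folklore] -/
theorem bsplineDensity_succ_re_le_of_le (hc : 0 < c) {k : ℕ}
    (ih : ∀ {x y : ℝ}, |x| ≤ |y| → (bsplineDensity c k y).re ≤ (bsplineDensity c k x).re) {x y : ℝ} (hx : 0 ≤ x) (hxy : x ≤ y) :
    (bsplineDensity c (k + 1) y).re ≤ (bsplineDensity c (k + 1) x).re := by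
  rw [bsplineDensity_succ_re_eq hc, bsplineDensity_succ_re_eq hc]
  refine div_le_div_of_nonneg_right ?_ (by positivity)
  -- `F(y+c) − F(x+c) ≤ F(y−c) − F(x−c)`
  have hint := integrable_bsplineDensity_re c k
  have h1 : bsplineCDF c k (y + c) - bsplineCDF c k (x + c) = ∫ s in x..y, (bsplineDensity c k (s + c)).re := by
    rw [bsplineCDF_sub_eq_integral, intervalIntegral.integral_comp_add_right (fun s ↦ (bsplineDensity c k s).re)]
  have h2 : bsplineCDF c k (y - c) - bsplineCDF c k (x - c) = ∫ s in x..y, (bsplineDensity c k (s - c)).re := by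
    rw [bsplineCDF_sub_eq_integral, intervalIntegral.integral_comp_sub_right (fun s ↦ (bsplineDensity c k s).re)]
  have hmono : ∫ s in x..y, (bsplineDensity c k (s + c)).re ≤ ∫ s in x..y, (bsplineDensity c k (s - c)).re := by
    refine intervalIntegral.integral_mono_on hxy ((hint.comp_add_right c).intervalIntegrable)
      ((hint.comp_sub_right c).intervalIntegrable) fun s hs ↦ ih ?_
    -- `|s − c| ≤ |s + c|` for `s ≥ 0`
    have hs0 : 0 ≤ s := hx.trans hs.1
    rw [abs_of_nonneg (by linarith : 0 ≤ s + c)]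
    exact abs_le.2 ⟨by linarith, by linarith⟩
  linarith

/-- **The B-spline density is non-increasing in `|t|`**: `|x| ≤ |y| → re ρ_k(y) ≤ re ρ_k(x)` (`c > 0`). [folklore: convolution powers of a
symmetric unimodal density are symmetric unimodal] -/
theorem bsplineDensity_re_le_of_abs_le (hc : 0 < c) : ∀ (k : ℕ) {x y : ℝ}, |x| ≤ |y| →
    (bsplineDensity c k y).re ≤ (bsplineDensity c k x).re
  | 0, x, y, hxy => by
      show (unifDensity c y).re ≤ (unifDensity c x).re
      rw [unifDensity_apply, unifDensity_apply]
      by_cases hy : y ∈ Icc (-c) c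
      · have hx : x ∈ Icc (-c) c := by
          rw [mem_Icc] at hy ⊢
          have : |y| ≤ c := abs_le.2 ⟨hy.1, hy.2⟩
          exact abs_le.1 (hxy.trans this)
        rw [if_pos hy, if_pos hx]
      · rw [if_neg hy]
        split_ifs
        · rw [Complex.ofReal_re]; positivity
        · simp
  | k + 1, x, y, hxy => by
      -- reduce to `0 ≤ |x| ≤ |y|` by evenness
      have ex : (bsplineDensity c (k + 1) x).re = (bsplineDensity c (k + 1) |x|).re := by
        rcases abs_choice x with h | h
        · rw [h]
        · rw [h, bsplineDensity_neg]
      have ey : (bsplineDensity c (k + 1) y).re = (bsplineDensity c (k + 1) |y|).re := by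
        rcases abs_choice y with h | h
        · rw [h]
        · rw [h, bsplineDensity_neg]
      rw [ex, ey]
      exact bsplineDensity_succ_re_le_of_le hc (fun hab ↦ bsplineDensity_re_le_of_abs_le hc k hab) (abs_nonneg x) hxy

/-! ## §2 The cellwise supremum of `|χ′(x₁ − t)|` -/

namespace ThetaParams

variable (P : ThetaParams)

/-- The point of `[lo, hi]` nearest `η/2`, `t* = max lo (min (η/2) hi)`, minimises `|t − η/2|` over the cell. [folklore] -/
theorem abs_clamp_sub_le {lo hi t a : ℝ} (h1 : lo ≤ t) (h2 : t ≤ hi) : |max lo (min a hi) - a| ≤ |t - a| := by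
  rcases le_or_gt a lo with ha | ha
  · -- mode below the cell: t* = lo
    have hmin : min a hi ≤ lo := (min_le_left _ _).trans ha
    rw [max_eq_left hmin, abs_of_nonneg (by linarith), abs_of_nonneg (by linarith)]
    linarith
  · rcases le_or_gt a hi with hb | hb
    · -- mode inside: t* = a
      rw [min_eq_left hb, max_eq_right ha.le, sub_self, abs_zero]; exact abs_nonneg _
    · -- mode above: t* = hi
      rw [min_eq_right hb.le, max_eq_right (h1.trans h2), abs_of_nonpos (by linarith), abs_of_nonpos (by linarith)]
      linarith

/-- **The cellwise bound of the cut's derivative**: for `t ∈ [lo, hi]`,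
`|χ′(x₁ − t)| ≤ re ρ(t* − η/2)`, `ρ = bsplineDensity (η/(2m)) (m−1)`, `t* = max lo (min (η/2) hi)` (= SPEC §1's `(m/η)·f_IH(m; m t*/η)`, §3).
[TIER2-KERNEL-SPEC §1 (`cpList`), §5 (K1)] -/
theorem abs_cut_deriv_depth_le_cell (hη : 0 < P.η) (hm : 1 ≤ P.m) {lo hi t : ℝ} (h1 : lo ≤ t) (h2 : t ≤ hi) :
    |(bsplineDensity (P.η / (2 * P.m)) (P.m - 1) (P.x₁ - t + P.a - P.η / 2)).re| ≤
      (bsplineDensity (P.η / (2 * P.m)) (P.m - 1) (max lo (min (P.η / 2) hi) - P.η / 2)).re := by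
  have hc := P.cut_scale_pos hη hm
  rw [abs_of_nonneg (bsplineDensity_re_nonneg hc.le _ _), P.cut_deriv_arg,
    show P.η / 2 - t = -(t - P.η / 2) by ring, bsplineDensity_neg]
  exact bsplineDensity_re_le_of_abs_le hc _ (abs_clamp_sub_le h1 h2)

/-! ## §3 The exactly evaluable form of the cut's density -/

/-- **`re ρ(v) = (m/η)·(irwinHall (m−1) s − irwinHall (m−1) (s − 1))`, `s = m(v + η/2)/η`** (`ρ = bsplineDensity (η/(2m)) (m−1)`, `m ≥ 2`;
`f_IH(m; s) = IH_{m−1}(s) − IH_{m−1}(s−1)`). [folklore: Irwin–Hall; TIER2-KERNEL-SPEC §1] -/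
theorem bsplineDensity_re_eq_irwinHall_sub (hη : 0 < P.η) (hm : 2 ≤ P.m) (v : ℝ) :
    (bsplineDensity (P.η / (2 * P.m)) (P.m - 1) v).re =
      P.m / P.η * (irwinHall (P.m - 1) (P.m * (v + P.η / 2) / P.η) - irwinHall (P.m - 1) (P.m * (v + P.η / 2) / P.η - 1)) := by
  have hc := P.cut_scale_pos hη (by omega)
  have hm0 : (0 : ℝ) < P.m := Nat.cast_pos.2 (by omega)
  obtain ⟨k, hk⟩ : ∃ k, P.m - 1 = k + 1 := ⟨P.m - 2, by omega⟩
  rw [hk, bsplineDensity_succ_re_eq hc, bsplineCDF_eq_irwinHall hc, bsplineCDF_eq_irwinHall hc]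
  have hk1 : k + 1 = P.m - 1 := hk.symm
  rw [hk1]
  have hcast : ((k : ℝ) + 1) = (P.m : ℝ) - 1 := by
    have : ((k + 1 : ℕ) : ℝ) = ((P.m - 1 : ℕ) : ℝ) := by rw [hk1]
    push_cast at this
    rw [Nat.cast_sub (by omega : 1 ≤ P.m)] at this
    push_cast at this
    linarith
  have e1 : (v + P.η / (2 * P.m) + ((k : ℝ) + 1) * (P.η / (2 * P.m))) / (2 * (P.η / (2 * P.m))) = P.m * (v + P.η / 2) / P.η := by
    rw [hcast]; field_simp; ring
  have e2 : (v - P.η / (2 * P.m) + ((k : ℝ) + 1) * (P.η / (2 * P.m))) / (2 * (P.η / (2 * P.m))) = P.m * (v + P.η / 2) / P.η - 1 := by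
    rw [hcast]; field_simp; ring
  rw [e1, e2]
  field_simp

end ThetaParams

end Summit.RiemannHypothesis.RiemannHypothesis.Theorems.WeilColumn.ThetaMellin
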